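import Literature.Topology.FourManifolds.TubeReadable
import Literature.Topology.FourManifolds.TubeSphereFamily
import Literature.Topology.FourManifolds.TubeLinkFamily
import Literature.Topology.FourManifolds.TubeUntwistFamily
import Literature.Topology.FourManifolds.TubeLink
import Literature.Topology.FourManifolds.TubeLogPacing
import Literature.Topology.FourManifolds.ClosedBallProofs
import Mathlib.Geometry.Manifold.PartitionOfUnity
import HarnessLib

/-!
# Construction of an admissible untwist family from a readable shell and `H_q`

Topic `Literature/Topology/FourManifolds`; the family half of the stage theorem of the downward sweep
(smoothing of PD homeomorphisms; Munkres, Ann. of Math. 72 (1960), §5; Campbell–D'Onofrio–Vítek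
(2026), Lemma 3.2 Step 4 / Lemma 3.4 Step 1).  Given the normal part `N` of the current map with a
readable shell over a convex base `V` (`ShellReadable`, `TubeReadable.lean`), sphere links of
dimension `k ≥ 2`, a base point `x₀ ∈ V`, a cutoff `χ` (one on the tube base `V'`, supported in
`V`) and a diffeotopy `D` of `𝕊ᵏ` with `D₁ ∘ R = ĥ(x₀, ·)` (from the hypothesis `H_{k+1}` applied to
the link diffeomorphism at `x₀`), the unit family

  `tubeFamily θ₀ D Rs N r χ x₀ = sphereFamily θ₀ (concatSphereFamily D Rs (globalizeFamily χ x₀ ĥ) x₀)`,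
  `ĥ = linkSphereMap θ₀ N (r/4)`,

together with the log-slow pacing `logPacing t₀ (3r/32)` is admissible over `V'`
(`familyAdmissible_tubeFamily`).  We also construct the link DIFFEOMORPHISM at `x₀`
(`exists_linkDiffeomorph`, `ShellReadable.exists_linkDiffeomorph`: smooth with injective
differential pointwise on the link sphere, hence a diffeomorphism for `k ≥ 2`) and extract `D`,
`R` from the dichotomy `H` (`exists_diffeotopy_of_dichotomy`).
Everything is proved; the only definition is the explicit function `tubeFamily`; no named facts.

## References

* J. R. Munkres, *Obstructions to the smoothing of piecewise-differentiable homeomorphisms*, Ann.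
  of Math. (2) 72 (1960), 521–554, §5. [Munkres1960]
* D. Campbell, L. D'Onofrio, T. Vítek, *Diffeomorphic approximation of piecewise affine
  homeomorphisms*, J. Geom. Anal. 36 (2026), Lemma 3.2, Lemma 3.4. [CampbellDonofrioVitek2026]
-/

noncomputable section

open Set Function Metric Filter Module
open scoped Topology ContDiff Manifold RealInnerProductSpace

namespace Literature.Topology.FourManifolds

/-! ### The link diffeomorphism at a base point (`k ≥ 2`) -/

section Link

variable {k : ℕ} {E : Type*} [NormedAddCommGroup E] [NormedSpace ℝ E]

local notation "𝔽[" n "]" => EuclideanSpace ℝ (Fin (n + 1))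
local notation "𝕊[" n "]" => (Metric.sphere (0 : EuclideanSpace ℝ (Fin (n + 1))) 1)

variable {θ₀ : 𝕊[k]} {N : E × 𝔽[k] → 𝔽[k]} {x₀ : E} {r₁ : ℝ}

/-- **The link diffeomorphism.** If `N` is smooth and nonzero at the points `(x₀, r₁ θ)` of the
link sphere, with injective fibre derivative and radially transversal there (`r₁ > 0`, `k ≥ 2`),
then the link stage `linkSphereMap θ₀ N r₁ x₀` is (the underlying map of) a diffeomorphism of `𝕊ᵏ`:
it is smooth with injective differential (`injective_mfderiv_linkSphereMap`), hence a local
diffeomorphism, hence a diffeomorphism, `𝕊ᵏ` being compact, connected and simply connected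
(`Literature.Geometry.Riemannian.diffeomorphOfIsLocalDiffeomorph`).  Only pointwise data on the
link sphere are used. [cite: CampbellDonofrioVitek2026, Lemma 3.4 (Step 1)] -/
theorem exists_linkDiffeomorph (hk : 2 ≤ k) (hr : 0 < r₁)
    (hN : ∀ θ : 𝕊[k], ContDiffAt ℝ ∞ N (x₀, r₁ • (θ : 𝔽[k])))
    (hN0 : ∀ θ : 𝕊[k], N (x₀, r₁ • (θ : 𝔽[k])) ≠ 0)
    (hinj : ∀ θ : 𝕊[k], ∀ u : 𝔽[k], fderiv ℝ N (x₀, r₁ • (θ : 𝔽[k])) (0, u) = 0 → u = 0)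
    (htr : ∀ θ : 𝕊[k], ∀ v : 𝔽[k], fderiv ℝ N (x₀, r₁ • (θ : 𝔽[k])) (0, v) = N (x₀, r₁ • (θ : 𝔽[k])) →
      0 < ⟪v, (θ : 𝔽[k])⟫) :
    ∃ φ : 𝕊[k] ≃ₘ⟮𝓡 k, 𝓡 k⟯ 𝕊[k], ∀ θ, φ θ = linkSphereMap θ₀ N r₁ x₀ θ := by
  haveI : Fact (finrank ℝ (EuclideanSpace ℝ (Fin (k + 1))) = k + 1) := ⟨finrank_euclideanSpace_fin⟩
  set ĥ : 𝕊[k] → 𝕊[k] := linkSphereMap θ₀ N r₁ x₀ with hĥ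
  -- smooth, as the composite of the jointly smooth family with `θ ↦ (x₀, θ)`
  have hsm : ContMDiff (𝓡 k) (𝓡 k) ∞ ĥ := fun θ =>
    (contMDiffAt_uncurry_linkSphereMap (θ₀ := θ₀) (hN θ) (hN0 θ)).comp θ
      (contMDiffAt_const.prodMk contMDiffAt_id)
  -- injective, hence invertible, differential
  have hkey : ∀ θ, Injective (mfderiv (𝓡 k) (𝓡 k) ĥ θ) := fun θ =>
    injective_mfderiv_linkSphereMap hr (hN θ) (hN0 θ) (hinj θ) (htr θ)
  have hloc : IsLocalDiffeomorph (𝓡 k) (𝓡 k) ∞ ĥ := by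
    intro θ
    set L : EuclideanSpace ℝ (Fin k) ≃L[ℝ] EuclideanSpace ℝ (Fin k) :=
      LinearEquiv.toContinuousLinearEquiv
        (LinearEquiv.ofInjectiveEndo (mfderiv (𝓡 k) (𝓡 k) ĥ θ).toLinearMap (hkey θ)) with hL
    refine isLocalDiffeomorphAt_of_mfderiv isOpen_univ (mem_univ θ) hsm.contMDiffOn (by simp) L ?_
    ext v
    rfl
  -- global: compact, connected, simply connected
  haveI : ConnectedSpace 𝕊[k] := by
    refine isConnected_iff_connectedSpace.1 (isConnected_sphere ?_ 0 zero_le_one)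
    rw [← Module.finrank_eq_rank, finrank_euclideanSpace_fin]
    exact_mod_cast (show 1 < k + 1 by omega)
  haveI : SimplyConnectedSpace 𝕊[k] :=
    Literature.AlgebraicTopology.FundamentalGroup.simplyConnectedSpace_euclideanSphere k hk
  haveI : LocallyPathConnectedSpace 𝕊[k] :=
    ChartedSpace.locallyPathConnectedSpace (EuclideanSpace ℝ (Fin k)) _
  exact ⟨Literature.Geometry.Riemannian.diffeomorphOfIsLocalDiffeomorph hloc, fun θ => rfl⟩

end Link


/-! ### The admissible family -/

section Family

variable {k : ℕ} {E : Type*} [NormedAddCommGroup E] [NormedSpace ℝ E]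

local notation "𝔽[" n "]" => EuclideanSpace ℝ (Fin (n + 1))
local notation "𝕊[" n "]" => (Metric.sphere (0 : EuclideanSpace ℝ (Fin (n + 1))) 1)

/-- Normalising a positive multiple. [folklore] -/
theorem inv_norm_smul_smul_of_pos {F : Type*} [NormedAddCommGroup F] [NormedSpace ℝ F] {c : ℝ} (hc : 0 < c)
    (v : F) : ‖c • v‖⁻¹ • (c • v) = ‖v‖⁻¹ • v := by
  by_cases hv : v = 0
  · simp [hv]
  · rw [norm_smul, Real.norm_eq_abs, abs_of_pos hc, mul_inv, smul_smul, mul_comm c⁻¹, mul_assoc,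
      inv_mul_cancel₀ hc.ne', mul_one]

/-- **The tube's untwist family**: the unit family of the concatenation (rigid map `Rs` → diffeotopy
`D` → link at the base point → base-point contraction → globalised link family of `N` at radius
`r/4`). [folklore] -/
def tubeFamily (θ₀ : 𝕊[k]) (D : Diffeotopy (𝓡 k) 𝕊[k]) (Rs : 𝕊[k] → 𝕊[k]) (N : E × 𝔽[k] → 𝔽[k]) (r : ℝ)
    (χ : E → ℝ) (x₀ : E) : ℝ → E × 𝔽[k] → 𝔽[k] :=
  sphereFamily θ₀ (concatSphereFamily D Rs (globalizeFamily χ x₀ (linkSphereMap θ₀ N (r / 4))) x₀)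

variable {θ₀ : 𝕊[k]} {D : Diffeotopy (𝓡 k) 𝕊[k]} {Rs : 𝕊[k] → 𝕊[k]} {N : E × 𝔽[k] → 𝔽[k]} {r : ℝ}
  {χ : E → ℝ} {x₀ : E} {V V' B : Set E} {T : E × 𝔽[k] → E} {ρ K₀ C₁ : ℝ}

/-- The link data of a readable shell at the link radius `r/4`: at `(x, (r/4) θ)`, `x ∈ V`, the map
`N` is smooth, nonzero, fibre-injective and radially transversal. [folklore] -/
theorem ShellReadable.linkData (hS : ShellReadable V r ρ K₀ C₁ T N) (hr : 0 < r) {x : E} (hx : x ∈ V)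
    (θ : 𝕊[k]) :
    ContDiffAt ℝ ∞ N (x, (r / 4) • (θ : 𝔽[k])) ∧ N (x, (r / 4) • (θ : 𝔽[k])) ≠ 0 ∧
      (∀ u : 𝔽[k], fderiv ℝ N (x, (r / 4) • (θ : 𝔽[k])) (0, u) = 0 → u = 0) ∧
      (∀ v : 𝔽[k], fderiv ℝ N (x, (r / 4) • (θ : 𝔽[k])) (0, v) = N (x, (r / 4) • (θ : 𝔽[k])) →
        0 < ⟪v, (θ : 𝔽[k])⟫) := by
  have hr4 : (0 : ℝ) < r / 4 := by positivity
  have hθ1 : ‖(θ : 𝔽[k])‖ = 1 := norm_eq_of_mem_sphere θ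
  have hn : ‖(r / 4) • (θ : 𝔽[k])‖ = r / 4 := by
    rw [norm_smul_of_nonneg hr4.le, hθ1, mul_one]
  set q : E × 𝔽[k] := (x, (r / 4) • (θ : 𝔽[k])) with hq
  have hxq : q.1 ∈ V := hx
  have hq2 : ‖q.2‖ = r / 4 := hn
  have h1 : r / 4 ≤ ‖q.2‖ := hq2.ge
  have h2 : ‖q.2‖ ≤ r := by rw [hq2]; linarith
  refine ⟨hS.contDiffAt_N q hxq h1 h2, hS.N_ne_zero q hxq hq2, hS.fibre_injective q hxq h1 h2,
    fun v hv => ?_⟩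
  have h : 0 < ⟪v, (r / 4) • (θ : 𝔽[k])⟫ := hS.transversal q hxq hq2 v hv
  rw [real_inner_smul_right] at h
  exact pos_of_mul_pos_right h hr4.le

/-- **The link diffeomorphism of a readable shell** at a base point `x₀ ∈ V` (`k ≥ 2`).
[cite: CampbellDonofrioVitek2026, Lemma 3.4 (Step 1)] -/
theorem ShellReadable.exists_linkDiffeomorph (hS : ShellReadable V r ρ K₀ C₁ T N) (hk : 2 ≤ k)
    (hr : 0 < r) (hx₀ : x₀ ∈ V) :
    ∃ φ : 𝕊[k] ≃ₘ⟮𝓡 k, 𝓡 k⟯ 𝕊[k], ∀ θ, φ θ = linkSphereMap θ₀ N (r / 4) x₀ θ :=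
  Literature.Topology.FourManifolds.exists_linkDiffeomorph hk (by positivity)
    (fun θ => (hS.linkData hr hx₀ θ).1)
    (fun θ => (hS.linkData hr hx₀ θ).2.1) (fun θ => (hS.linkData hr hx₀ θ).2.2.1)
    fun θ => (hS.linkData hr hx₀ θ).2.2.2

/-- Stages of a diffeomorphism of the sphere have injective differential. [folklore] -/
theorem injective_mfderiv_sphereDiffeomorph (φ : 𝕊[k] ≃ₘ⟮𝓡 k, 𝓡 k⟯ 𝕊[k]) (θ : 𝕊[k]) :
    Injective (mfderiv (𝓡 k) (𝓡 k) φ θ) := by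
  haveI : Fact (finrank ℝ (EuclideanSpace ℝ (Fin (k + 1))) = k + 1) := ⟨finrank_euclideanSpace_fin⟩
  have h := (φ.mfderivToContinuousLinearEquiv (by simp) θ).injective
  rwa [show ⇑(φ.mfderivToContinuousLinearEquiv (by simp) θ) = ⇑(mfderiv (𝓡 k) (𝓡 k) φ θ) from
    congrArg DFunLike.coe (φ.mfderivToContinuousLinearEquiv_coe (by simp))] at h

/-- **Untwist data from the dichotomy `H_{k+1}`.** If the link diffeomorphism `φ` is diffeotopic
to the identity or to the reflection `sphereReflection v`, then there are a diffeotopy `D` of the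
sphere and a rigid diffeomorphism `Rs` (the identity or the reflection), restriction of a linear
isometry `R` of the ambient Euclidean space, with `D₁ ∘ Rs = φ`. [folklore] -/
theorem exists_diffeotopy_of_dichotomy {v : 𝕊[k]} {φ : 𝕊[k] ≃ₘ⟮𝓡 k, 𝓡 k⟯ 𝕊[k]}
    (h : Diffeomorph.IsDiffeotopicToId φ ∨ Diffeomorph.IsDiffeotopic (sphereReflection v) φ) :
    ∃ (D : Diffeotopy (𝓡 k) 𝕊[k]) (Rs : 𝕊[k] ≃ₘ⟮𝓡 k, 𝓡 k⟯ 𝕊[k]) (R : 𝔽[k] →ₗᵢ[ℝ] 𝔽[k]),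
      Surjective R ∧ (∀ θ : 𝕊[k], ((Rs θ : 𝕊[k]) : 𝔽[k]) = R θ) ∧
        ∀ θ : 𝕊[k], D.toFun 1 (Rs θ) = φ θ := by
  rcases h with ⟨D, hD⟩ | ⟨D, hD⟩
  · refine ⟨D, Diffeomorph.refl (𝓡 k) 𝕊[k] ∞, LinearIsometry.id, surjective_id, fun θ => rfl,
      fun θ => ?_⟩
    rw [← Diffeotopy.coe_stage, hD]
    rfl
  · refine ⟨D, sphereReflection v, ((ℝ ∙ (v : 𝔽[k]))ᗮ.reflection).toLinearIsometry,
      ((ℝ ∙ (v : 𝔽[k]))ᗮ.reflection).surjective, fun θ => rfl, fun θ => ?_⟩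
    rw [← Diffeotopy.coe_stage, hD, Diffeomorph.coe_trans, Function.comp_apply,
      Diffeomorph.symm_apply_apply]

/-- **The tube family is admissible over the core base `V'`.** Hypotheses: a readable shell over a
convex `V ∋ x₀` (plus smoothness of `N` on the open annulus around the link level at `x₀` is NOT
needed here — only the link-level data); a smooth cutoff `χ ∈ [0, 1]`, `= 1` on `V'`, `= 0` off
`B ⊆ V`; a rigid map `Rs` which is the restriction of the linear isometry `R`, smooth with
injective differentials; a diffeotopy `D` matching the link at the base point, `D₁ ∘ Rs = ĥ(x₀, ·)`;
and a core radius `0 < t₀ < 3r/32` for the log-slow pacing. [folklore] -/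
theorem familyAdmissible_tubeFamily (hr : 0 < r) (hS : ShellReadable V r ρ K₀ C₁ T N)
    (hVc : Convex ℝ V) (hx₀ : x₀ ∈ V) (hBV : B ⊆ V) (hV'V : V' ⊆ V)
    (hχ : ContDiff ℝ ∞ χ) (hχ01 : ∀ x, χ x ∈ Icc (0 : ℝ) 1) (hχB : ∀ x ∉ B, χ x = 0)
    (hχV' : ∀ x ∈ V', χ x = 1)
    {R : 𝔽[k] →ₗᵢ[ℝ] 𝔽[k]} (hRs : ∀ θ : 𝕊[k], (Rs θ : 𝔽[k]) = R θ)
    (hRsm : ContMDiff (𝓡 k) (𝓡 k) ∞ Rs) (hRinj : ∀ θ, Injective (mfderiv (𝓡 k) (𝓡 k) Rs θ))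
    (hmatch : ∀ θ, D.toFun 1 (Rs θ) = linkSphereMap θ₀ N (r / 4) x₀ θ)
    {t₀ : ℝ} (ht₀ : 0 < t₀) (ht₀r : t₀ < 3 * r / 32) :
    FamilyAdmissible V' r R t₀ N (tubeFamily θ₀ D Rs N r χ x₀) (logPacing t₀ (3 * r / 32)) := by
  haveI : Fact (finrank ℝ (EuclideanSpace ℝ (Fin (k + 1))) = k + 1) := ⟨finrank_euclideanSpace_fin⟩
  -- notation
  set ĥ := linkSphereMap θ₀ N (r / 4) with hĥ
  set ĝ := globalizeFamily χ x₀ ĥ with hĝ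
  set G := concatSphereFamily D Rs ĝ x₀ with hG
  have hr4 : 0 < r / 4 := by positivity
  -- points of `V` reached by the globalisation
  have hseg : ∀ x ∈ B, ∀ x' ∈ segment ℝ x₀ x, x' ∈ V := fun x hx x' hx' =>
    hVc.segment_subset hx₀ (hBV hx) hx'
  have hmoved : ∀ x : E, x₀ + χ x • (x - x₀) ∈ V := by
    intro x
    by_cases hxB : x ∈ B
    · exact hseg x hxB _ (globalize_point_mem_segment hχ01 x)
    · rw [hχB x hxB, zero_smul, add_zero]; exact hx₀
  -- smoothness of the link family on `V`
  have hĥsm : ∀ x ∈ V, ∀ θ : 𝕊[k], ContMDiffAt (𝓘(ℝ, E).prod (𝓡 k)) (𝓡 k) ∞ (uncurry ĥ) (x, θ) := by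
    intro x hx θ
    obtain ⟨h1, h2, -, -⟩ := hS.linkData hr hx θ
    exact contMDiffAt_uncurry_linkSphereMap h1 h2
  have hĝsm : ContMDiff (𝓘(ℝ, E).prod (𝓡 k)) (𝓡 k) ∞ (uncurry ĝ) :=
    contMDiff_uncurry_globalizeFamily hχ hχ01 hχB (fun x hx x' hx' θ => hĥsm x' (hseg x hx x' hx') θ)
      (fun θ => hĥsm x₀ hx₀ θ)
  -- matching at the base point
  have hmatch' : ∀ θ, D.toFun 1 (Rs θ) = ĝ x₀ θ := by
    intro θ
    rw [hmatch θ, hĝ, globalizeFamily, sub_self, smul_zero, add_zero]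
  have hGsm : ContMDiff (𝓘(ℝ, ℝ).prod (𝓘(ℝ, E).prod (𝓡 k))) (𝓡 k) ∞ (uncurry G) :=
    contMDiff_uncurry_concatSphereFamily hRsm hĝsm hmatch'
  -- injectivity of the stage differentials of `ĝ`
  have hĝinj : ∀ (x : E) (θ : 𝕊[k]), Injective (mfderiv (𝓡 k) (𝓡 k) (ĝ x) θ) := by
    intro x θ
    obtain ⟨h1, h2, h3, h4⟩ := hS.linkData hr (hmoved x) θ
    exact injective_mfderiv_linkSphereMap hr4 h1 h2 h3 h4
  have hGinj : ∀ (s : ℝ) (x : E) (θ : 𝕊[k]),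
      Injective (mfderiv (𝓡 k) (𝓡 k) (fun θ' => G s (x, θ')) θ) := fun s x θ =>
    injective_mfderiv_concatSphereFamily_stage hRsm hRinj hĝinj s x θ
  have h332 : t₀ < 3 * r / 32 := ht₀r
  refine
    { contDiffAt := fun s q hq => contDiffAt_uncurry_sphereFamily hGsm hq.2
      eq_link := ?_
      eq_zero := ?_
      norm_eq_one := fun s q _ => norm_sphereFamily s q
      ker := fun s q hq w hw h0 => sphereFamily_ker hGsm hq.2 (hGinj s q.1 _) w hw h0
      lam_contDiffAt := fun t ht => contDiffAt_logPacing ht₀ h332 ht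
      lam_two := fun t ht => logPacing_of_ge ht₀ h332 ht
      lam_zero := fun t ht => logPacing_of_le ht₀ h332 ht
      t₀_pos := ht₀ }
  · -- `s ≥ 2`: the link family, i.e. the normalised link field
    intro s hs q hq
    have hq0 : q.2 ≠ 0 := hq.2
    have hN0 : N (q.1, (r / 4) • (radialProjection θ₀ q.2 : 𝔽[k])) ≠ 0 :=
      (hS.linkData hr (hV'V hq.1) _).2.1
    rw [tubeFamily, sphereFamily_apply, ← hĥ, ← hĝ, ← hG, hG, concatSphereFamily_of_two_le hs, hĝ,
      globalizeFamily_of_eq_one (hχV' q.1 hq.1), hĥ, coe_linkSphereMap hN0,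
      coe_radialProjection_of_ne_zero θ₀ hq0, smul_smul, linkField, inv_norm_smul_smul_of_pos (by positivity)]
    rfl
  · -- `s = 0`: the rigid map
    intro q hq
    have hq0 : q.2 ≠ 0 := hq.2
    rw [tubeFamily, sphereFamily_apply, ← hĥ, ← hĝ, ← hG, hG, concatSphereFamily_of_nonpos le_rfl, hRs,
      coe_radialProjection_of_ne_zero θ₀ hq0]

/-- **The admissible family of a readable shell (sphere links, `k ≥ 2`).** From a readable
shell over a convex base, the dichotomy `H_{k+1}` for the diffeomorphisms of `𝕊ᵏ`, a base point
`x₀ ∈ V` and a cutoff `χ` (values in `[0, 1]`, `= 1` on `V' ⊆ V`, `= 0` off `B ⊆ V`), we get the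
untwist data `D`, `Rs`, `R` (with `R` surjective, `Rs` its restriction) such that for EVERY core
radius `0 < t₀ < 3r/32` the tube family with the log-slow pacing is admissible over `V'`: the
core depth remains a free parameter of the stage (it is fixed later, after the faces' radii, to
make the exported Euler defect small).  Munkres (1960), §5; Campbell–D'Onofrio–Vítek (2026),
Lemma 3.4, Step 1 and Lemma 3.2, Step 4. [cite: CampbellDonofrioVitek2026, Lemma 3.4] -/
theorem ShellReadable.exists_familyAdmissible (hS : ShellReadable V r ρ K₀ C₁ T N) (hk : 2 ≤ k)
    (H : ∀ (v : 𝕊[k]) (φ : 𝕊[k] ≃ₘ⟮𝓡 k, 𝓡 k⟯ 𝕊[k]),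
      Diffeomorph.IsDiffeotopicToId φ ∨ Diffeomorph.IsDiffeotopic (sphereReflection v) φ)
    (hr : 0 < r) (hVc : Convex ℝ V) (hx₀ : x₀ ∈ V) (hBV : B ⊆ V) (hV'V : V' ⊆ V)
    (hχ : ContDiff ℝ ∞ χ) (hχ01 : ∀ x, χ x ∈ Icc (0 : ℝ) 1) (hχB : ∀ x ∉ B, χ x = 0)
    (hχV' : ∀ x ∈ V', χ x = 1) :
    ∃ (D : Diffeotopy (𝓡 k) 𝕊[k]) (Rs : 𝕊[k] ≃ₘ⟮𝓡 k, 𝓡 k⟯ 𝕊[k]) (R : 𝔽[k] →ₗᵢ[ℝ] 𝔽[k]),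
      Surjective R ∧ (∀ θ : 𝕊[k], ((Rs θ : 𝕊[k]) : 𝔽[k]) = R θ) ∧
        (∀ θ : 𝕊[k], D.toFun 1 (Rs θ) = linkSphereMap θ₀ N (r / 4) x₀ θ) ∧
        ∀ t₀ : ℝ, 0 < t₀ → t₀ < 3 * r / 32 →
          FamilyAdmissible V' r R t₀ N (tubeFamily θ₀ D Rs N r χ x₀) (logPacing t₀ (3 * r / 32)) := by
  obtain ⟨φ, hφ⟩ := hS.exists_linkDiffeomorph (θ₀ := θ₀) hk hr hx₀
  obtain ⟨D, Rs, R, hRsurj, hRs, hD⟩ := exists_diffeotopy_of_dichotomy (H θ₀ φ)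
  refine ⟨D, Rs, R, hRsurj, hRs, fun θ => (hD θ).trans (hφ θ), fun t₀ ht₀ ht₀r => ?_⟩
  exact familyAdmissible_tubeFamily hr hS hVc hx₀ hBV hV'V hχ hχ01 hχB hχV' hRs Rs.contMDiff
    (injective_mfderiv_sphereDiffeomorph Rs) (fun θ => (hD θ).trans (hφ θ)) ht₀ ht₀r

/-- **The sphere-link stage (codimension `k + 1 ≥ 3`) in one chart pair.** From a readable
shell (with the universal constants `K₀ ≥ 1`, `C₁` valid at the radius `r` and round radius
`ρ > 0`), the dichotomy `H_{k+1}`, a base point and a cutoff which is `1` on the open core base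
`V' ⊆ V`: there are untwist data `D`, `Rs`, `R` such that for EVERY core depth `0 < t₀ < 3r/32`
the tube family is admissible over `V'` and the tube stage map
`tubeStageMap r ρ T N (tubeFamily …) (logPacing t₀ (3r/32))` is `C^∞` with invertible derivative at
every point of the open tube `V' × B(0, r)` (it agrees with the input `(T, N)` from radius `7r/8`
on, `tubeStageMap_of_ge`).  Munkres (1960), §5; Campbell–D'Onofrio–Vítek (2026), Lemma 3.4 and
§4. [cite: CampbellDonofrioVitek2026, Lemma 3.4] -/
theorem ShellReadable.exists_sphereStage [FiniteDimensional ℝ E]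
    (hS : ShellReadable V r ρ K₀ C₁ T N) (hk : 2 ≤ k)
    (H : ∀ (v : 𝕊[k]) (φ : 𝕊[k] ≃ₘ⟮𝓡 k, 𝓡 k⟯ 𝕊[k]),
      Diffeomorph.IsDiffeotopicToId φ ∨ Diffeomorph.IsDiffeotopic (sphereReflection v) φ)
    (hr : 0 < r) (hVc : Convex ℝ V) (hV'o : IsOpen V') (hx₀ : x₀ ∈ V) (hBV : B ⊆ V)
    (hV'V : V' ⊆ V) (hχ : ContDiff ℝ ∞ χ) (hχ01 : ∀ x, χ x ∈ Icc (0 : ℝ) 1)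
    (hχB : ∀ x ∉ B, χ x = 0) (hχV' : ∀ x ∈ V', χ x = 1) (hK₀1 : 1 ≤ K₀)
    (hK₀ : ∀ t : ℝ, 0 < t → t ≤ r / 2 → |1 - t * deriv (stagePacing r) t / stagePacing r t| ≤ K₀)
    (hρ : 0 < ρ) (hC₁ : ∀ t : ℝ, |deriv (flattenCutoff r) t| ≤ C₁ / r) :
    ∃ (D : Diffeotopy (𝓡 k) 𝕊[k]) (Rs : 𝕊[k] ≃ₘ⟮𝓡 k, 𝓡 k⟯ 𝕊[k]) (R : 𝔽[k] →ₗᵢ[ℝ] 𝔽[k]),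
      Surjective R ∧ (∀ θ : 𝕊[k], ((Rs θ : 𝕊[k]) : 𝔽[k]) = R θ) ∧
        (∀ θ : 𝕊[k], D.toFun 1 (Rs θ) = linkSphereMap θ₀ N (r / 4) x₀ θ) ∧
        ∀ t₀ : ℝ, 0 < t₀ → t₀ < 3 * r / 32 →
          FamilyAdmissible V' r R t₀ N (tubeFamily θ₀ D Rs N r χ x₀) (logPacing t₀ (3 * r / 32)) ∧
          ∀ p : E × 𝔽[k], p.1 ∈ V' → ‖p.2‖ < r →
            ContDiffAt ℝ ∞
                (tubeStageMap r ρ T N (tubeFamily θ₀ D Rs N r χ x₀) (logPacing t₀ (3 * r / 32))) p ∧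
              ∃ L : (E × 𝔽[k]) ≃L[ℝ] E × 𝔽[k],
                HasFDerivAt
                  (tubeStageMap r ρ T N (tubeFamily θ₀ D Rs N r χ x₀) (logPacing t₀ (3 * r / 32)))
                  (L : E × 𝔽[k] →L[ℝ] E × 𝔽[k]) p := by
  obtain ⟨D, Rs, R, hRsurj, hRs, hD, hadm⟩ :=
    hS.exists_familyAdmissible (θ₀ := θ₀) hk H hr hVc hx₀ hBV hV'V hχ hχ01 hχB hχV'
  refine ⟨D, Rs, R, hRsurj, hRs, hD, fun t₀ ht₀ ht₀r => ⟨hadm t₀ ht₀ ht₀r, fun p hp1 hpr => ?_⟩⟩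
  have hS' : ShellReadable V' r ρ K₀ C₁ T N := hS.subset hV'V
  exact ⟨hS'.contDiffAt_tubeStageMap (hadm t₀ ht₀ ht₀r) hr hV'o hp1 hpr,
    hS'.exists_hasFDerivAt_equiv_tubeStageMap (hadm t₀ ht₀ ht₀r) hr hV'o hRsurj hK₀1 hK₀ hρ hC₁
      hp1 hpr⟩

end Family

end Literature.Topology.FourManifolds
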